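import Literature.LinearAlgebra.Matrix.ModularEuclid
import Literature.Computability.Complexity.CodeFPArith
import Literature.Computability.Complexity.CodeFPLists
import HarnessLib

/-!
# The modular Euclid engines in polynomial time on codes

Topic `Literature/Computability/Complexity`; the machine side of
`Literature/LinearAlgebra/Matrix/ModularEuclid.lean`.  The two-line engines of the modular
diagonalisation (`ModDiag.estep`/`euclid` on a pair of rows, `ModDiag.cstep`/`ceuclid` on a pair of
columns of a row list, and the key dynamics `ModDiag.kstep`/`kiter`, which also computes gcds) are
run by polynomial-time string functions in the typed `FP` algebra `CodeFP` (`CodeFP.lean`):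

* `msub_codeFP`, `axpy_codeFP`, `estep_codeFP`; the fuelled loop `euclidL` (a left fold of `estep`
  over a unary budget, `euclidL_eq : euclidL N l k = euclid N |l| k`) and **`euclidL_codeFP`**;
* `kstep_codeFP`, `kiterL`/`kiterL_eq`/`kiterL_codeFP`, and **`gcdSucc_codeFP`**
  (`(p, N) ↦ gcd (p, N + 1)`, the budget `2 · |bin (N+1)| + 1` read off the code);
* `colOp_codeFP`, `swapCols_codeFP`, `cstep_codeFP`, `ceuclidL`/`ceuclidL_eq`/**`ceuclidL_codeFP`**.

The one hypothesis of `CodeFP.foldl` — a polynomial bound on the code of the accumulator along the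
run, on EVERY input — holds because the engines never lengthen a row and every entry they write is
a residue `≤ N` (`RowSmall`: all entries have codes no longer than the whole input).

## References

* S. Arora, B. Barak, *Computational Complexity: A Modern Approach*, CUP 2009, §1.3 (polynomial
  time is closed under composition and polynomially bounded loops) [AroraBarak2009].
* A. Schrijver, *Theory of Linear and Integer Programming*, Wiley 1986, §5.3 (arithmetic modulo a
  subdeterminant keeps the numbers of the elimination polynomially bounded) [Schrijver1986].
-/

namespace Literature.Computability.Complexity

namespace ModDiagFP

open CodeFP Polynomial _root_.Computability Literature.LinearAlgebra.Matrix
  Literature.LinearAlgebra.Matrix.ModDiag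

/-- Rows of naturals: raw lists of binary numerals. -/
local notation "rowE" => rawE natE

/-- Row lists. -/
local notation "matE" => rawE (rawE natE)

/-! ### Size bookkeeping -/

/-- A row is `W`-SMALL: at most `W` entries, each with a binary code of length `≤ W`. [folklore] -/
def RowSmall (W : ℕ) (r : List ℕ) : Prop := r.length ≤ W ∧ ∀ e ∈ r, (natE e).length ≤ W

/-- A row list is `W`-SMALL: at most `W` rows, each `W`-small. [folklore] -/
def MatSmall (W : ℕ) (M : List (List ℕ)) : Prop := M.length ≤ W ∧ ∀ r ∈ M, RowSmall W r

/-- Binary numerals have `Nat.size` bits. [folklore] -/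
theorem length_natE_eq_size (n : ℕ) : (natE n).length = n.size := TM2Pass.length_encodeNat_eq_size n

/-- The length of binary numerals is monotone. [folklore] -/
theorem length_natE_mono {a b : ℕ} (h : a ≤ b) : (natE a).length ≤ (natE b).length := by
  rw [length_natE_eq_size, length_natE_eq_size]; exact Nat.size_le_size h

/-- The raw code of a list all of whose item codes are `≤ B` long. [folklore] -/
theorem length_rawE_le_of_forall {α : Type} (e : α → List Bool) {l : List α} {B : ℕ}
    (h : ∀ x ∈ l, (e x).length ≤ B) : (rawE e l).length ≤ l.length * (2 * B + 2) := by
  rw [length_rawE]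
  calc (l.map fun a => 2 * (e a).length + 2).sum ≤ (l.map fun a => 2 * (e a).length + 2).length • (2 * B + 2) :=
        List.sum_le_card_nsmul _ _ fun x hx => by
          obtain ⟨a, ha, rfl⟩ := List.mem_map.1 hx
          have := h a ha; omega
    _ = l.length * (2 * B + 2) := by rw [List.length_map, smul_eq_mul]

/-- The code of a small row. [folklore] -/
theorem length_rawE_le_of_rowSmall {W : ℕ} {r : List ℕ} (h : RowSmall W r) :
    (rawE natE r).length ≤ W * (2 * W + 2) :=
  (length_rawE_le_of_forall natE h.2).trans (Nat.mul_le_mul_right _ h.1)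

/-- The code of a small row list. [folklore] -/
theorem length_rawE_le_of_matSmall {W : ℕ} {M : List (List ℕ)} (h : MatSmall W M) :
    (rawE (rawE natE) M).length ≤ W * (2 * (W * (2 * W + 2)) + 2) :=
  (length_rawE_le_of_forall (rawE natE) fun r hr => length_rawE_le_of_rowSmall (h.2 r hr)).trans
    (Nat.mul_le_mul_right _ h.1)

/-- A row read off a code of length `W` is `W`-small. [folklore] -/
theorem rowSmall_of_length_le {W : ℕ} {r : List ℕ} (h : (rawE natE r).length ≤ W) : RowSmall W r :=
  ⟨(length_le_length_rawE natE r).trans h, fun e he => by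
    have := length_item_le_length_rawE natE he; omega⟩

/-- A row list read off a code of length `W` is `W`-small. [folklore] -/
theorem matSmall_of_length_le {W : ℕ} {M : List (List ℕ)} (h : (rawE (rawE natE) M).length ≤ W) : MatSmall W M :=
  ⟨(length_le_length_rawE (rawE natE) M).trans h, fun r hr => rowSmall_of_length_le
    (by have := length_item_le_length_rawE (rawE natE) hr; omega)⟩

/-- A residue `≤ N` has a short code when `N` has. [folklore] -/
theorem length_natE_le_of_lt {W N e : ℕ} (hN : (natE N).length ≤ W) (he : e < N + 1) : (natE e).length ≤ W :=
  (length_natE_mono (Nat.lt_succ_iff.1 he)).trans hN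

/-- `axpy` of small rows is small (its entries are residues). [folklore] -/
theorem rowSmall_axpy {W N q : ℕ} {u v : List ℕ} (hN : (natE N).length ≤ W) (hv : RowSmall W v) :
    RowSmall W (axpy N q u v) := by
  refine ⟨?_, fun e he => ?_⟩
  · rw [axpy, List.length_zipWith]; exact (min_le_left _ _).trans hv.1
  · obtain ⟨a, -, b, -, rfl⟩ := exists_of_mem_zipWith (by simpa [axpy] using he)
    exact length_natE_le_of_lt hN (msub_lt N _ _)

/-- `estep` keeps a pair of small rows small. [folklore] -/
theorem rowSmall_estep {W N : ℕ} {k : List ℕ × List ℕ} (hN : (natE N).length ≤ W) (h1 : RowSmall W k.1)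
    (h2 : RowSmall W k.2) : RowSmall W (estep N k).1 ∧ RowSmall W (estep N k).2 := by
  unfold estep
  split_ifs
  · exact ⟨h1, h2⟩
  · exact ⟨h1, rowSmall_axpy hN h2⟩
  · exact ⟨rowSmall_axpy hN h2, h1⟩

/-! ### Modular subtraction and `axpy` -/

/-- **`msub` on codes**: `(N, a, t) ↦ (a mod (N+1) + (N + 1 − t mod (N+1))) mod (N+1)`. [cite: AroraBarak2009, §1.3] -/
theorem msub_codeFP : CodeFP (pairE natE (pairE natE natE)) natE (fun t => msub t.1 t.2.1 t.2.2) := by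
  let tE := pairE natE (pairE natE natE)
  have pm : CodeFP tE natE (fun t => t.1 + 1) := natAdd.comp ((fst _ _).pair (const _ 1))
  have pa : CodeFP tE natE (fun t => t.2.1) := (snd _ _).fst'
  have pt : CodeFP tE natE (fun t => t.2.2) := (snd _ _).snd'
  have h1 : CodeFP tE natE (fun t => t.2.1 % (t.1 + 1)) := natMod.comp (pa.pair pm)
  have h2 : CodeFP tE natE (fun t => t.1 + 1 - t.2.2 % (t.1 + 1)) := natSub.comp (pm.pair (natMod.comp (pt.pair pm)))
  exact (natMod.comp ((natAdd.comp (h1.pair h2)).pair pm)).congr fun _ => rfl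

/-- **`axpy` on codes**: `((N, q), u, v) ↦ v − q • u` reduced. [cite: AroraBarak2009, §1.3] -/
theorem axpy_codeFP :
    CodeFP (pairE (pairE natE natE) (pairE rowE rowE)) rowE (fun t => axpy t.1.1 t.1.2 t.2.1 t.2.2) := by
  -- the item map `((N, q), a, b) ↦ msub N a (q b)` (with `a` from `v`, `b` from `u`)
  have hg : CodeFP (pairE (pairE natE natE) (pairE natE natE)) natE (fun t => msub t.1.1 t.2.1 (t.1.2 * t.2.2)) :=
    msub_codeFP.comp ((fst _ _).fst'.pair ((snd _ _).fst'.pair (natMul.comp ((fst _ _).snd'.pair (snd _ _).snd'))))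
  have hz := zipWith (σ := ℕ × ℕ) (eσ := pairE natE natE) (eα := natE) (eβ := natE) (eγ := natE) hg
  exact (hz.comp ((fst _ _).pair ((snd _ _).snd'.pair (snd _ _).fst'))).congr fun _ => rfl

/-! ### Euclid on a pair of rows -/

/-- **`estep` on codes** (context `N`). [cite: AroraBarak2009, §1.3] -/
theorem estep_codeFP : CodeFP (pairE natE (pairE rowE rowE)) (pairE rowE rowE) (fun t => estep t.1 t.2) := by
  let tE := pairE natE (pairE rowE rowE)
  have pN : CodeFP tE natE (fun t => t.1) := fst _ _
  have pu : CodeFP tE rowE (fun t => t.2.1) := (snd _ _).fst'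
  have pv : CodeFP tE rowE (fun t => t.2.2) := (snd _ _).snd'
  have get0 : CodeFP rowE natE (fun r => r.getD 0 0) := (rawGetD natE (d := 0) natE_zero).comp ((CodeFP.id _).pair (const _ 0))
  have pa : CodeFP tE natE (fun t => t.2.2.getD 0 0) := get0.comp pv
  have pp : CodeFP tE natE (fun t => t.2.1.getD 0 0) := get0.comp pu
  have pq : CodeFP tE natE (fun t => t.2.2.getD 0 0 / t.2.1.getD 0 0) := natDiv.comp (pa.pair pp)
  have pv' : CodeFP tE rowE (fun t => axpy t.1 (t.2.2.getD 0 0 / t.2.1.getD 0 0) t.2.1 t.2.2) :=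
    axpy_codeFP.comp ((pN.pair pq).pair (pu.pair pv))
  have ha0 : CodeFP tE bitE (fun t => decide (t.2.2.getD 0 0 = 0)) := natEq.comp (pa.pair (const _ 0))
  have hv0 : CodeFP tE bitE (fun t => decide ((axpy t.1 (t.2.2.getD 0 0 / t.2.1.getD 0 0) t.2.1 t.2.2).getD 0 0 = 0)) :=
    natEq.comp ((get0.comp pv').pair (const _ 0))
  refine ((ha0.ite (snd _ _) (hv0.ite (pu.pair pv') (pv'.pair pu))).congr fun t => ?_)
  simp only [estep, decide_eq_true_eq]

/-- The fuelled Euclid loop: a left fold of `estep` over a budget list. [folklore] -/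
def euclidL (N : ℕ) (l : List Unit) (k : List ℕ × List ℕ) : List ℕ × List ℕ := l.foldl (fun k _ => estep N k) k

/-- The fuelled loop is `euclid` with fuel the length of the budget. [folklore] -/
theorem euclidL_eq (N : ℕ) (l : List Unit) (k : List ℕ × List ℕ) : euclidL N l k = euclid N l.length k := by
  induction l generalizing k with
  | nil => rfl
  | cons u l ih => rw [euclidL, List.foldl_cons, ← euclidL, ih, List.length_cons, euclid]

/-- The Euclid fold keeps a pair of small rows small. [folklore] -/
theorem rowSmall_euclidL {W N : ℕ} (hN : (natE N).length ≤ W) (l : List Unit) {k : List ℕ × List ℕ}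
    (h1 : RowSmall W k.1) (h2 : RowSmall W k.2) : RowSmall W (euclidL N l k).1 ∧ RowSmall W (euclidL N l k).2 := by
  induction l generalizing k with
  | nil => exact ⟨h1, h2⟩
  | cons u l ih =>
    rw [euclidL, List.foldl_cons, ← euclidL]
    obtain ⟨h1', h2'⟩ := rowSmall_estep hN h1 h2
    exact ih h1' h2'

/-- **`euclidL` on codes**: `((N, k), budget) ↦ euclidL N budget k`. [cite: AroraBarak2009, §1.3 (polynomially bounded loops)] -/
theorem euclidL_codeFP :
    CodeFP (pairE (pairE natE (pairE rowE rowE)) (rawE unitE)) (pairE rowE rowE) (fun p => euclidL p.1.1 p.2 p.1.2) := by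
  have hstep : CodeFP (pairE (pairE natE (pairE rowE rowE)) (pairE unitE (pairE rowE rowE))) (pairE rowE rowE)
      (fun t => estep t.1.1 t.2.2) := estep_codeFP.comp ((fst _ _).fst'.pair (snd _ _).snd')
  have hinit : CodeFP (pairE natE (pairE rowE rowE)) (pairE rowE rowE) (fun s => s.2) := snd _ _
  refine (foldl (σ := ℕ × (List ℕ × List ℕ)) (α := Unit) (β := List ℕ × List ℕ)
    (eσ := pairE natE (pairE rowE rowE)) (eα := unitE) (eβ := pairE rowE rowE)
    (step := fun s _ k => estep s.1 k) (init := fun s => s.2) hstep hinit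
    (3 * (X * (2 * X + 2)) + 2) fun s l₁ l₂ => ?_).congr fun _ => rfl
  obtain ⟨N, k⟩ := s
  set W := (pairE (pairE natE (pairE rowE rowE)) (rawE unitE) ((N, k), l₁ ++ l₂)).length with hW
  have hWN : (natE N).length ≤ W := by simp only [hW, pairE_apply, length_boolPair]; omega
  have hk1 : (rawE natE k.1).length ≤ W := by simp only [hW, pairE_apply, length_boolPair]; omega
  have hk2 : (rawE natE k.2).length ≤ W := by simp only [hW, pairE_apply, length_boolPair]; omega
  obtain ⟨h1, h2⟩ := rowSmall_euclidL hWN l₁ (k := k) (rowSmall_of_length_le hk1) (rowSmall_of_length_le hk2)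
  have e : l₁.foldl (fun k (_ : Unit) => estep N k) k = euclidL N l₁ k := rfl
  rw [e]
  have b1 := length_rawE_le_of_rowSmall h1
  have b2 := length_rawE_le_of_rowSmall h2
  simp only [pairE_apply, length_boolPair, eval_add, eval_mul, eval_ofNat, eval_X]
  nlinarith [b1, b2]

/-- **`euclid` on codes**, the fuel given as the length of a budget list:
`((N, k), budget) ↦ euclid N |budget| k`. [cite: AroraBarak2009, §1.3] -/
theorem euclid_codeFP :
    CodeFP (pairE (pairE natE (pairE rowE rowE)) (rawE unitE)) (pairE rowE rowE) (fun p => euclid p.1.1 p.2.length p.1.2) :=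
  euclidL_codeFP.congr fun p => euclidL_eq p.1.1 p.2 p.1.2

/-- `euclid` keeps a pair of small rows small. [folklore] -/
theorem rowSmall_euclid {W N : ℕ} (hN : (natE N).length ≤ W) (F : ℕ) {k : List ℕ × List ℕ}
    (h1 : RowSmall W k.1) (h2 : RowSmall W k.2) : RowSmall W (euclid N F k).1 ∧ RowSmall W (euclid N F k).2 := by
  induction F generalizing k with
  | zero => exact ⟨h1, h2⟩
  | succ F ih =>
    rw [euclid]
    obtain ⟨h1', h2'⟩ := rowSmall_estep hN h1 h2
    exact ih h1' h2'

/-! ### The key dynamics and the gcd -/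

/-- **`kstep` on codes.** [cite: AroraBarak2009, §1.3] -/
theorem kstep_codeFP : CodeFP (pairE natE natE) (pairE natE natE) kstep := by
  have pp : CodeFP (pairE natE natE) natE (fun k => k.1) := fst _ _
  have pa : CodeFP (pairE natE natE) natE (fun k => k.2) := snd _ _
  have hr : CodeFP (pairE natE natE) natE (fun k => k.2 % k.1) := natMod.comp (pa.pair pp)
  have h0 : CodeFP (pairE natE natE) bitE (fun k => decide (k.2 = 0)) := natEq.comp (pa.pair (const _ 0))
  have h1 : CodeFP (pairE natE natE) bitE (fun k => decide (k.2 % k.1 = 0)) := natEq.comp (hr.pair (const _ 0))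
  refine ((h0.ite (pp.pair pa) (h1.ite (pp.pair (const _ 0)) (hr.pair pp))).congr fun k => ?_)
  simp only [kstep, decide_eq_true_eq, Prod.mk.eta]

/-- The fuelled key loop. [folklore] -/
def kiterL (l : List Unit) (k : ℕ × ℕ) : ℕ × ℕ := l.foldl (fun k _ => kstep k) k

/-- The fuelled key loop is `kiter`. [folklore] -/
theorem kiterL_eq (l : List Unit) (k : ℕ × ℕ) : kiterL l k = kiter l.length k := by
  induction l generalizing k with
  | nil => rfl
  | cons u l ih => rw [kiterL, List.foldl_cons, ← kiterL, ih, List.length_cons, kiter]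

/-- `kstep` does not increase the larger key. [folklore] -/
theorem kstep_le (k : ℕ × ℕ) : (kstep k).1 ≤ max k.1 k.2 ∧ (kstep k).2 ≤ max k.1 k.2 := by
  unfold kstep
  split_ifs with h0 h1
  · exact ⟨le_max_left _ _, le_max_right _ _⟩
  · exact ⟨le_max_left _ _, Nat.zero_le _⟩
  · refine ⟨?_, le_max_left _ _⟩
    rcases Nat.eq_zero_or_pos k.1 with hp | hp
    · rw [hp, Nat.mod_zero]; exact le_max_right _ _
    · exact ((Nat.mod_lt _ hp).le).trans (le_max_left _ _)

/-- The key loop does not increase the larger key. [folklore] -/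
theorem kiterL_le (l : List Unit) (k : ℕ × ℕ) : (kiterL l k).1 ≤ max k.1 k.2 ∧ (kiterL l k).2 ≤ max k.1 k.2 := by
  induction l generalizing k with
  | nil => exact ⟨le_max_left _ _, le_max_right _ _⟩
  | cons u l ih =>
    rw [kiterL, List.foldl_cons, ← kiterL]
    obtain ⟨h1, h2⟩ := ih (kstep k)
    have h3 := kstep_le k
    exact ⟨h1.trans (max_le h3.1 h3.2), h2.trans (max_le h3.1 h3.2)⟩

/-- **`kiterL` on codes**: `(k, budget) ↦ kiterL budget k`. [cite: AroraBarak2009, §1.3 (polynomially bounded loops)] -/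
theorem kiterL_codeFP : CodeFP (pairE (pairE natE natE) (rawE unitE)) (pairE natE natE) (fun p => kiterL p.2 p.1) := by
  have hstep : CodeFP (pairE (pairE natE natE) (pairE unitE (pairE natE natE))) (pairE natE natE) (fun t => kstep t.2.2) :=
    kstep_codeFP.comp (snd _ _).snd'
  refine (foldl (σ := ℕ × ℕ) (α := Unit) (β := ℕ × ℕ) (eσ := pairE natE natE) (eα := unitE) (eβ := pairE natE natE)
    (step := fun _ _ k => kstep k) (init := fun s => s) hstep (CodeFP.id _) (3 * X + 2) fun s l₁ l₂ => ?_).congr fun _ => rfl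
  set W := (pairE (pairE natE natE) (rawE unitE) (s, l₁ ++ l₂)).length with hW
  have h1 : (natE s.1).length ≤ W := by simp only [hW, pairE_apply, length_boolPair]; omega
  have h2 : (natE s.2).length ≤ W := by simp only [hW, pairE_apply, length_boolPair]; omega
  have hm : (natE (max s.1 s.2)).length ≤ W := by rcases le_total s.1 s.2 with h | h <;> simp [h, h1, h2]
  obtain ⟨b1, b2⟩ := kiterL_le l₁ s
  have e : l₁.foldl (fun k (_ : Unit) => kstep k) s = kiterL l₁ s := rfl
  rw [e]
  have c1 := (length_natE_mono b1).trans hm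
  have c2 := (length_natE_mono b2).trans hm
  simp only [pairE_apply, length_boolPair, eval_add, eval_mul, eval_ofNat, eval_X]
  omega

/-- **The gcd with the modulus on codes**: `(p, N) ↦ gcd (p, N + 1)`, by `2 |bin (N+1)| + 1` key steps
from `(N + 1, p)`. [cite: AroraBarak2009, §1.3] -/
theorem gcdSucc_codeFP : CodeFP (pairE natE natE) natE (fun t => Nat.gcd t.1 (t.2 + 1)) := by
  have pm : CodeFP (pairE natE natE) natE (fun t => t.2 + 1) := natAdd.comp ((snd _ _).pair (const _ 1))
  -- the budget `2 |bin (N+1)| + 1` in unary, as a list of units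
  have hlen : CodeFP (pairE natE natE) unE (fun t => (natE (t.2 + 1)).length) := strLength.comp (strOfNat.comp pm)
  have hbud : CodeFP (pairE natE natE) (rawE unitE) (fun t => List.replicate (2 * (natE (t.2 + 1)).length + 1) ()) :=
    replicateUnit.comp ((unSucc.comp (unAdd.comp (hlen.pair hlen))).congr fun t => by simp [two_mul])
  refine ((kiterL_codeFP.comp ((pm.pair (fst _ _)).pair hbud)).fst'.congr fun t => ?_)
  obtain ⟨p, N⟩ := t
  simp only
  rw [kiterL_eq, List.length_replicate, length_natE_eq_size,
    kiter_spec (N := N + 1) (Nat.succ_pos N) le_rfl le_rfl, Nat.gcd_comm]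

/-! ### Euclid on a pair of columns -/

/-- **`colOp` on codes**: `((N, j, q), r) ↦ r.set j (msub N r[j] (q r[0]))`. [cite: AroraBarak2009, §1.3] -/
theorem colOp_codeFP : CodeFP (pairE (pairE natE (pairE natE natE)) rowE) rowE (fun t => colOp t.1.1 t.1.2.1 t.1.2.2 t.2) := by
  let tE := pairE (pairE natE (pairE natE natE)) rowE
  have pN : CodeFP tE natE (fun t => t.1.1) := (fst _ _).fst'
  have pj : CodeFP tE natE (fun t => t.1.2.1) := (fst _ _).snd'.fst'
  have pq : CodeFP tE natE (fun t => t.1.2.2) := (fst _ _).snd'.snd'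
  have pr : CodeFP tE rowE (fun t => t.2) := snd _ _
  have gj : CodeFP tE natE (fun t => t.2.getD t.1.2.1 0) := (rawGetD natE (d := 0) natE_zero).comp (pr.pair pj)
  have g0 : CodeFP tE natE (fun t => t.2.getD 0 0) := (rawGetD natE (d := 0) natE_zero).comp (pr.pair (const _ 0))
  have hv : CodeFP tE natE (fun t => msub t.1.1 (t.2.getD t.1.2.1 0) (t.1.2.2 * t.2.getD 0 0)) :=
    msub_codeFP.comp (pN.pair (gj.pair (natMul.comp (pq.pair g0))))
  exact ((setAt natE).comp (pr.pair (pj.pair hv))).congr fun _ => rfl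

/-- **`swapCols` on codes**: `(j, r) ↦ (r.set 0 r[j]).set j r[0]`. [cite: AroraBarak2009, §1.3] -/
theorem swapCols_codeFP : CodeFP (pairE natE rowE) rowE (fun t => swapCols t.1 t.2) := by
  let tE := pairE natE rowE
  have pj : CodeFP tE natE (fun t => t.1) := fst _ _
  have pr : CodeFP tE rowE (fun t => t.2) := snd _ _
  have gj : CodeFP tE natE (fun t => t.2.getD t.1 0) := (rawGetD natE (d := 0) natE_zero).comp (pr.pair pj)
  have g0 : CodeFP tE natE (fun t => t.2.getD 0 0) := (rawGetD natE (d := 0) natE_zero).comp (pr.pair (const _ 0))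
  have h1 : CodeFP tE rowE (fun t => t.2.set 0 (t.2.getD t.1 0)) := (setAt natE).comp (pr.pair ((const _ 0).pair gj))
  exact ((setAt natE).comp (h1.pair (pj.pair g0))).congr fun _ => rfl

/-- **`cstep` on codes** (context `(N, j)`). [cite: AroraBarak2009, §1.3] -/
theorem cstep_codeFP : CodeFP (pairE (pairE natE natE) matE) matE (fun t => cstep t.1.1 t.1.2 t.2) := by
  let tE := pairE (pairE natE natE) matE
  have pN : CodeFP tE natE (fun t => t.1.1) := (fst _ _).fst'
  have pj : CodeFP tE natE (fun t => t.1.2) := (fst _ _).snd'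
  have pM : CodeFP tE matE (fun t => t.2) := snd _ _
  have top : CodeFP matE rowE (fun M => M.headD []) := rawHeadD (rawE natE) (d := []) rfl
  have get : CodeFP (pairE rowE natE) natE (fun p => p.1.getD p.2 0) := rawGetD natE (d := 0) natE_zero
  have pa : CodeFP tE natE (fun t => (t.2.headD []).getD t.1.2 0) := get.comp ((top.comp pM).pair pj)
  have pp : CodeFP tE natE (fun t => (t.2.headD []).getD 0 0) := get.comp ((top.comp pM).pair (const _ 0))
  have pq : CodeFP tE natE (fun t => (t.2.headD []).getD t.1.2 0 / (t.2.headD []).getD 0 0) := natDiv.comp (pa.pair pp)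
  -- `M.map (colOp N j q)` with context `(N, j, q)`
  have hmapC := map (σ := ℕ × ℕ × ℕ) (eσ := pairE natE (pairE natE natE)) (eα := rowE)
    (g := fun t => colOp t.1.1 t.1.2.1 t.1.2.2 t.2) colOp_codeFP
  have pM' : CodeFP tE matE (fun t => t.2.map (colOp t.1.1 t.1.2 ((t.2.headD []).getD t.1.2 0 / (t.2.headD []).getD 0 0))) :=
    (hmapC.comp ((pN.pair (pj.pair pq)).pair pM)).congr fun _ => rfl
  -- `M'.map (swapCols j)` with context `j`
  have hmapS := map (σ := ℕ) (eσ := natE) (eα := rowE) (g := fun t => swapCols t.1 t.2) swapCols_codeFP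
  have pM'' : CodeFP tE matE (fun t => (t.2.map (colOp t.1.1 t.1.2 ((t.2.headD []).getD t.1.2 0 / (t.2.headD []).getD 0 0))).map
      (swapCols t.1.2)) := (hmapS.comp (pj.pair pM')).congr fun _ => rfl
  have ha0 : CodeFP tE bitE (fun t => decide ((t.2.headD []).getD t.1.2 0 = 0)) := natEq.comp (pa.pair (const _ 0))
  have hk0 : CodeFP tE bitE (fun t => decide (((t.2.map (colOp t.1.1 t.1.2 ((t.2.headD []).getD t.1.2 0 /
      (t.2.headD []).getD 0 0))).headD []).getD t.1.2 0 = 0)) := natEq.comp ((get.comp ((top.comp pM').pair pj)).pair (const _ 0))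
  refine ((ha0.ite pM (hk0.ite pM' pM'')).congr fun t => ?_)
  simp only [cstep, decide_eq_true_eq]

/-- The fuelled column loop. [folklore] -/
def ceuclidL (N : ℕ) (l : List Unit) (j : ℕ) (M : List (List ℕ)) : List (List ℕ) := l.foldl (fun M _ => cstep N j M) M

/-- The fuelled column loop is `ceuclid`. [folklore] -/
theorem ceuclidL_eq (N : ℕ) (l : List Unit) (j : ℕ) (M : List (List ℕ)) : ceuclidL N l j M = ceuclid N l.length j M := by
  induction l generalizing M with
  | nil => rfl
  | cons u l ih => rw [ceuclidL, List.foldl_cons, ← ceuclidL, ih, List.length_cons, ceuclid]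

/-- `colOp` keeps a small row small. [folklore] -/
theorem rowSmall_colOp {W N j q : ℕ} {r : List ℕ} (hN : (natE N).length ≤ W) (h : RowSmall W r) :
    RowSmall W (colOp N j q r) := by
  refine ⟨by rw [length_colOp]; exact h.1, fun e he => ?_⟩
  rw [colOp] at he
  rcases List.mem_or_eq_of_mem_set he with he | rfl
  · exact h.2 e he
  · exact length_natE_le_of_lt hN (msub_lt N _ _)

/-- An entry read with default `0` has a short code. [folklore] -/
theorem length_natE_getD_le {W : ℕ} {r : List ℕ} (h : RowSmall W r) (i : ℕ) : (natE (r.getD i 0)).length ≤ W := by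
  rw [List.getD_eq_getElem?_getD]
  cases hri : r[i]? with
  | none => simp
  | some a => exact h.2 a (List.mem_of_getElem? hri)

/-- `swapCols` keeps a small row small. [folklore] -/
theorem rowSmall_swapCols {W j : ℕ} {r : List ℕ} (h : RowSmall W r) : RowSmall W (swapCols j r) := by
  refine ⟨by rw [length_swapCols]; exact h.1, fun e he => ?_⟩
  rw [swapCols] at he
  rcases List.mem_or_eq_of_mem_set he with he | rfl
  · rcases List.mem_or_eq_of_mem_set he with he | rfl
    · exact h.2 e he
    · exact length_natE_getD_le h j
  · exact length_natE_getD_le h 0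

/-- `cstep` keeps a small row list small. [folklore] -/
theorem matSmall_cstep {W N j : ℕ} {M : List (List ℕ)} (hN : (natE N).length ≤ W) (h : MatSmall W M) :
    MatSmall W (cstep N j M) := by
  rcases cstep_cases (N := N) j M with e | ⟨q, e⟩ | ⟨q, e⟩ <;> rw [e]
  · exact h
  · exact ⟨by simpa using h.1, fun r hr => by
      obtain ⟨r', hr', rfl⟩ := List.mem_map.1 hr; exact rowSmall_colOp hN (h.2 r' hr')⟩
  · exact ⟨by simpa using h.1, fun r hr => by
      obtain ⟨r'', hr'', rfl⟩ := List.mem_map.1 hr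
      obtain ⟨r', hr', rfl⟩ := List.mem_map.1 hr''
      exact rowSmall_swapCols (rowSmall_colOp hN (h.2 r' hr'))⟩

/-- The column loop keeps a small row list small. [folklore] -/
theorem matSmall_ceuclidL {W N j : ℕ} (hN : (natE N).length ≤ W) (l : List Unit) {M : List (List ℕ)} (h : MatSmall W M) :
    MatSmall W (ceuclidL N l j M) := by
  induction l generalizing M with
  | nil => exact h
  | cons u l ih => rw [ceuclidL, List.foldl_cons, ← ceuclidL]; exact ih (matSmall_cstep hN h)

/-- **`ceuclidL` on codes**: `(((N, j), M), budget) ↦ ceuclidL N budget j M`. [cite: AroraBarak2009, §1.3 (polynomially bounded loops)] -/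
theorem ceuclidL_codeFP :
    CodeFP (pairE (pairE (pairE natE natE) matE) (rawE unitE)) matE (fun p => ceuclidL p.1.1.1 p.2 p.1.1.2 p.1.2) := by
  have hstep : CodeFP (pairE (pairE (pairE natE natE) matE) (pairE unitE matE)) matE (fun t => cstep t.1.1.1 t.1.1.2 t.2.2) :=
    cstep_codeFP.comp ((fst _ _).fst'.pair (snd _ _).snd')
  have hinit : CodeFP (pairE (pairE natE natE) matE) matE (fun s => s.2) := snd _ _
  refine (foldl (σ := (ℕ × ℕ) × List (List ℕ)) (α := Unit) (β := List (List ℕ))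
    (eσ := pairE (pairE natE natE) matE) (eα := unitE) (eβ := matE)
    (step := fun s _ M => cstep s.1.1 s.1.2 M) (init := fun s => s.2) hstep hinit
    (X * (2 * (X * (2 * X + 2)) + 2)) fun s l₁ l₂ => ?_).congr fun _ => rfl
  obtain ⟨⟨N, j⟩, M⟩ := s
  set W := (pairE (pairE (pairE natE natE) matE) (rawE unitE) (((N, j), M), l₁ ++ l₂)).length with hW
  have hWN : (natE N).length ≤ W := by simp only [hW, pairE_apply, length_boolPair]; omega
  have hM : (rawE (rawE natE) M).length ≤ W := by simp only [hW, pairE_apply, length_boolPair]; omega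
  have hsmall := matSmall_ceuclidL (j := j) hWN l₁ (matSmall_of_length_le hM)
  have e : l₁.foldl (fun M (_ : Unit) => cstep N j M) M = ceuclidL N l₁ j M := rfl
  rw [e]
  have b := length_rawE_le_of_matSmall hsmall
  simp only [eval_add, eval_mul, eval_ofNat, eval_X]
  exact b

/-- **`ceuclid` on codes**, the fuel given as the length of a budget list:
`(((N, j), M), budget) ↦ ceuclid N |budget| j M`. [cite: AroraBarak2009, §1.3] -/
theorem ceuclid_codeFP :
    CodeFP (pairE (pairE (pairE natE natE) matE) (rawE unitE)) matE (fun p => ceuclid p.1.1.1 p.2.length p.1.1.2 p.1.2) :=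
  ceuclidL_codeFP.congr fun p => ceuclidL_eq p.1.1.1 p.2 p.1.1.2 p.1.2

/-- `ceuclid` keeps a small row list small. [folklore] -/
theorem matSmall_ceuclid {W N j : ℕ} (hN : (natE N).length ≤ W) (F : ℕ) {M : List (List ℕ)} (h : MatSmall W M) :
    MatSmall W (ceuclid N F j M) := by
  induction F generalizing M with
  | zero => exact h
  | succ F ih => rw [ceuclid]; exact ih (matSmall_cstep hN h)

end ModDiagFP

end Literature.Computability.Complexity
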